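import Summits.CriticalPhenomena.PercolationContinuityZ3.Theorems.Transplant.SkelWinLevels
import Summits.CriticalPhenomena.PercolationContinuityZ3.Theorems.Transplant.SkelSeedKit
import HarnessLib

/-!
# L5.5a′ — the abstract seed kit of a window level with an INSTANCE-POLYMORPHIC `DecidableEq V` and face vertices allowed inside the
# region (lane convention p3-g4 2026-08-20 19:11:29Z (3); reshape ruling 18:39:38Z (A); companion of `SkelWinLevels`)

builds on p205010 (kernel theorem, internal audit signed; external expert review pending) — nothing in this file uses p205010.
Lane `prim-bschramm`, seat `prim-bschramm-p1` (gen 7); helper file (`--supports stmt-CriticalPhenomena-4575 --as helper`).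

This is `SkelSeedKit` (p232099; see its module docstring for the H₃ witness that makes the generic seed a REGION and not a plaquette)
re-typed over a `[DecidableEq V]` SECTION BINDER (so that every `outerBoundary` / `edgesIn` / `SHyp` term in the statements takes the
consumer's instance — the classical-only statements of `SkelSeedKit` cannot be applied under the node's binder without instance bridges),
with ONE mathematical change: a face vertex may lie IN the seed region (`KitOK.U_adj : u ∈ S x ∨ ∃ v ∈ S x, G.Adj v u`), which the
product's edge-contact remedy needs (a far contact has region = face = `{y}`).  The data `Skel.KitGeom` (`y`, `S`, `U`) and the inner
neighbour `Skel.inNbr` are imported; the seed, the Step-III data and the axioms are re-issued here (namespace `Transplant.SkelI`):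
* §1 `inNbr_spec` (bridge to the classical choice); §2 `kitSeed G κ x` (= contact edge ∪ `E(S x)` ∪ rungs), case analysis; §3 `KitOK`, `kitSData` (`K = ∂^{out}_{winGraph} B⟨j⟩`, `pick = apartSel` over
  `ballFin · (2 rs)`, `N = k (Δ+1)^{2rs}`, `sB = 1 + Δ cS + cS cU`); §4 `seed_notMem_wireSet`, **`shyp_kit`**.

[cite: KozmaNitzan2024, §4 Lemma 10, p. 19 (Step III, seeds; "the seeds are independent"), p. 21 (U(P)) — the ℤ^d model]
[cite: GrimmettPercolation1999, §7.2]
-/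

noncomputable section

open scoped Classical

namespace Summit.CriticalPhenomena.PercolationContinuityZ3.Theorems

namespace Transplant

namespace SkelI

open Literature.Probability.Percolation Literature.Probability.LatticeModels SimpleGraph KNLevels
open Literature.Barriers.CriticalPhenomena (graphBall graphBall_finite mem_graphBall_self graphBall_mono)
open BoxProdZ2 (ballFin mem_ballFin card_ballFin_le)
open Skel (winGraph winGraph_adj winLevel mem_winLevel_iff winLevel_monotone winLevel_subset_graphBall winLData winLData_X inNbr KitGeom)

variable {V : Type} [DecidableEq V] (G : SimpleGraph V) [G.LocallyFinite]

/-! ## §1 The inner neighbour of an outer-boundary vertex -/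

variable {G} in
/-- Specification of the inner neighbour (`Skel.inNbr`, a classical choice): adjacent to `x`, in the ball, skeleton coordinate in `P`.
[folklore] -/
theorem inNbr_spec (Φ : PlanarSkeletonConc G) {w₀ : V} {R : ℕ} {P : Finset (Site 2)} {x : V}
    (hx : x ∈ outerBoundary (winGraph G w₀ R) (Φ.Win w₀ P R)) :
    G.Adj x (inNbr Φ w₀ R P x) ∧ inNbr Φ w₀ R P x ∈ graphBall G w₀ R ∧ Φ.φ (inNbr Φ w₀ R P x) ∈ P := by
  obtain ⟨hx1, hxP, y, hxy, hy1, hyP⟩ := (mem_outerBoundary_win_iff Φ).1 hx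
  exact Skel.inNbr_spec Φ ((Skel.mem_outerBoundary_win_iff Φ).2 ⟨hx1, hxP, y, hxy, hy1, hyP⟩)

variable {G} in
/-- The inner neighbour lies in the window. [folklore] -/
theorem inNbr_mem_Win (Φ : PlanarSkeletonConc G) {w₀ : V} {R : ℕ} {P : Finset (Site 2)} {x : V}
    (hx : x ∈ outerBoundary (winGraph G w₀ R) (Φ.Win w₀ P R)) : inNbr Φ w₀ R P x ∈ Φ.Win w₀ P R :=
  (Φ.mem_Win).2 (inNbr_spec Φ hx).2

/-! ## §2 The seed of a seed geometry -/

/-- **The seed of `x`** for the geometry `κ`: the contact edge `x — y x`, all edges of `G` inside the region `S x`, and the rungs from `S x`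
into the face `U x`. [cite: KozmaNitzan2024, §4 p. 19 ("Call a given plaquette a seed if …")] -/
def kitSeed (κ : KitGeom V) (x : V) : Finset (Sym2 V) :=
  {s(x, κ.y x)} ∪ edgesIn G (κ.S x) ∪ ((κ.S x ×ˢ κ.U x).filter fun q => G.Adj q.1 q.2).image fun q => s(q.1, q.2)

variable {G}

/-- The contact edge is a seed edge. [folklore] -/
theorem contactEdge_mem_kitSeed (κ : KitGeom V) (x : V) : s(x, κ.y x) ∈ kitSeed G κ x :=
  Finset.mem_union.2 (Or.inl (Finset.mem_union.2 (Or.inl (Finset.mem_singleton_self _))))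

/-- Edges inside the region are seed edges. [folklore] -/
theorem edgesIn_subset_kitSeed (κ : KitGeom V) (x : V) : edgesIn G (κ.S x) ⊆ kitSeed G κ x := by
  intro e he
  simp only [kitSeed, Finset.mem_union]
  exact Or.inl (Or.inr he)

/-- Rungs are seed edges. [folklore] -/
theorem rung_mem_kitSeed (κ : KitGeom V) {x v u : V} (hv : v ∈ κ.S x) (hu : u ∈ κ.U x) (hvu : G.Adj v u) :
    s(v, u) ∈ kitSeed G κ x := by
  simp only [kitSeed, Finset.mem_union, Finset.mem_image, Finset.mem_filter, Finset.mem_product]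
  exact Or.inr ⟨(v, u), ⟨⟨hv, hu⟩, hvu⟩, rfl⟩

/-- **Case analysis of a seed edge**: the contact edge, an edge inside the region, or a rung. [folklore] -/
theorem mem_kitSeed_cases (κ : KitGeom V) {x : V} {e : Sym2 V} (he : e ∈ kitSeed G κ x) :
    e = s(x, κ.y x) ∨ e ∈ edgesIn G (κ.S x) ∨ ∃ v ∈ κ.S x, ∃ u ∈ κ.U x, G.Adj v u ∧ e = s(v, u) := by
  simp only [kitSeed, Finset.mem_union, Finset.mem_singleton, Finset.mem_image, Finset.mem_filter, Finset.mem_product] at he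
  rcases he with (h | h) | ⟨q, ⟨⟨hq1, hq2⟩, hadj⟩, rfl⟩
  · exact Or.inl h
  · exact Or.inr (Or.inl h)
  · exact Or.inr (Or.inr ⟨q.1, hq1, q.2, hq2, hadj, rfl⟩)

/-- Every seed edge has an endpoint in `{x} ∪ S x` and both endpoints in `{x, y x} ∪ S x ∪ U x`. [folklore] -/
theorem exists_mem_of_mem_kitSeed (κ : KitGeom V) {x : V} {e : Sym2 V} (he : e ∈ kitSeed G κ x) :
    (∃ z ∈ e, z = x ∨ z ∈ κ.S x) ∧ ∀ z ∈ e, z = x ∨ z = κ.y x ∨ z ∈ κ.S x ∨ z ∈ κ.U x := by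
  rcases mem_kitSeed_cases κ he with rfl | h | ⟨v, hv, u, hu, -, rfl⟩
  · exact ⟨⟨x, Sym2.mem_mk_left _ _, Or.inl rfl⟩, fun z hz => by
      rcases Sym2.mem_iff.1 hz with rfl | rfl
      · exact Or.inl rfl
      · exact Or.inr (Or.inl rfl)⟩
  · rw [mem_edgesIn_iff] at h
    induction e using Sym2.ind with
    | h a b =>
      exact ⟨⟨a, Sym2.mem_mk_left _ _, Or.inr (h.2 a (Sym2.mem_mk_left _ _))⟩,
        fun z hz => Or.inr (Or.inr (Or.inl (h.2 z hz)))⟩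
  · exact ⟨⟨v, Sym2.mem_mk_left _ _, Or.inr hv⟩, fun z hz => by
      rcases Sym2.mem_iff.1 hz with rfl | rfl
      · exact Or.inr (Or.inr (Or.inl hv))
      · exact Or.inr (Or.inr (Or.inr hu))⟩

variable (Φ : PlanarSkeletonConc G)

/-! ## §3 The kit hypotheses and the Step-III data -/

/-- **The hypotheses on a seed geometry at the window level `j`** (`K = ∂^{out}_{winGraph} B⟨j⟩`): inner neighbour adjacent to the contact and
in the region; region and face in `B⟨j⟩` and in `B_G(x, rs)`; region connected from the inner neighbour inside itself; every face vertex
in the region or adjacent to it; sizes `≤ cS`, `≤ cU`. [cite: KozmaNitzan2024, §4 p. 19 (Step III)] -/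
structure KitOK (w₀ : V) (R : ℕ) (lo hi : Site 2) (j rs cS cU : ℕ) (κ : KitGeom V) : Prop where
  adj : ∀ x ∈ outerBoundary (winGraph G w₀ R) (winLevel Φ w₀ R lo hi j), G.Adj x (κ.y x)
  y_mem : ∀ x ∈ outerBoundary (winGraph G w₀ R) (winLevel Φ w₀ R lo hi j), κ.y x ∈ κ.S x
  S_sub : ∀ x ∈ outerBoundary (winGraph G w₀ R) (winLevel Φ w₀ R lo hi j), κ.S x ⊆ winLevel Φ w₀ R lo hi j
  U_sub : ∀ x ∈ outerBoundary (winGraph G w₀ R) (winLevel Φ w₀ R lo hi j), κ.U x ⊆ winLevel Φ w₀ R lo hi j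
  S_ball : ∀ x ∈ outerBoundary (winGraph G w₀ R) (winLevel Φ w₀ R lo hi j), ∀ v ∈ κ.S x, v ∈ graphBall G x rs
  U_ball : ∀ x ∈ outerBoundary (winGraph G w₀ R) (winLevel Φ w₀ R lo hi j), ∀ u ∈ κ.U x, u ∈ graphBall G x rs
  S_path : ∀ x ∈ outerBoundary (winGraph G w₀ R) (winLevel Φ w₀ R lo hi j), ∀ v ∈ κ.S x, PathIn G (↑(κ.S x) : Set V) (κ.y x) v
  U_adj : ∀ x ∈ outerBoundary (winGraph G w₀ R) (winLevel Φ w₀ R lo hi j), ∀ u ∈ κ.U x, u ∈ κ.S x ∨ ∃ v ∈ κ.S x, G.Adj v u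
  S_card : ∀ x ∈ outerBoundary (winGraph G w₀ R) (winLevel Φ w₀ R lo hi j), (κ.S x).card ≤ cS
  U_card : ∀ x ∈ outerBoundary (winGraph G w₀ R) (winLevel Φ w₀ R lo hi j), (κ.U x).card ≤ cU

/-- **The seed data of the window level `j`**: candidate contacts = outer boundary of `B⟨j⟩` in the window graph, seeds `kitSeed`, faces
`κ.U`, greedy selection of `k` contacts pairwise at graph distance `> 2 rs` among `N = k (Δ+1)^{2 rs}`, seed bound `1 + Δ cS + cS cU`.
[cite: KozmaNitzan2024, §4 p. 19 (Step III)] -/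
def kitSData (w₀ : V) (R : ℕ) (lo hi : Site 2) (j : ℕ) (κ : KitGeom V) (rs cS cU k : ℕ) : SData V where
  K := outerBoundary (winGraph G w₀ R) (winLevel Φ w₀ R lo hi j)
  seed := kitSeed G κ
  face := κ.U
  pick := apartSel (fun x => ballFin G x (2 * rs)) (Skel.center_mem_ballFin' rs) (Skel.ballFin_symm' rs) (Skel.pow_succ_pos' Φ.Δ rs)
    (fun x => card_ballFin_le G Φ.degree_le x (2 * rs)) k
  N := k * (Φ.Δ + 1) ^ (2 * rs)
  k := k
  sB := 1 + Φ.Δ * cS + cS * cU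

/-- The candidate contacts of `kitSData`. [folklore] -/
@[simp] theorem kitSData_K (w₀ : V) (R : ℕ) (lo hi : Site 2) (j : ℕ) (κ : KitGeom V) (rs cS cU k : ℕ) :
    (kitSData Φ w₀ R lo hi j κ rs cS cU k).K = outerBoundary (winGraph G w₀ R) (winLevel Φ w₀ R lo hi j) := rfl

/-- The seeds of `kitSData`. [folklore] -/
@[simp] theorem kitSData_seed (w₀ : V) (R : ℕ) (lo hi : Site 2) (j : ℕ) (κ : KitGeom V) (rs cS cU k : ℕ) :
    (kitSData Φ w₀ R lo hi j κ rs cS cU k).seed = kitSeed G κ := rfl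

/-- The faces of `kitSData`. [folklore] -/
@[simp] theorem kitSData_face (w₀ : V) (R : ℕ) (lo hi : Site 2) (j : ℕ) (κ : KitGeom V) (rs cS cU k : ℕ) :
    (kitSData Φ w₀ R lo hi j κ rs cS cU k).face = κ.U := rfl

/-- The selection of `kitSData` is a subset. [folklore] -/
theorem kitSData_pick_subset (w₀ : V) (R : ℕ) (lo hi : Site 2) (j : ℕ) (κ : KitGeom V) (rs cS cU k : ℕ) (c : Finset V) :
    (kitSData Φ w₀ R lo hi j κ rs cS cU k).pick c ⊆ c :=
  apartSel_subset (fun x => ballFin G x (2 * rs)) (Skel.center_mem_ballFin' rs) (Skel.ballFin_symm' rs) (Skel.pow_succ_pos' Φ.Δ rs)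
    (fun x => card_ballFin_le G Φ.degree_le x (2 * rs)) k c

/-- The selection of `kitSData` on large sets: `k` elements, pairwise at graph distance `> 2 rs`. [folklore] -/
theorem kitSData_pick_spec (w₀ : V) (R : ℕ) (lo hi : Site 2) (j : ℕ) (κ : KitGeom V) (rs cS cU k : ℕ) {c : Finset V}
    (hc : k * (Φ.Δ + 1) ^ (2 * rs) ≤ c.card) :
    ((kitSData Φ w₀ R lo hi j κ rs cS cU k).pick c).card = k ∧
      ∀ x ∈ (kitSData Φ w₀ R lo hi j κ rs cS cU k).pick c, ∀ x' ∈ (kitSData Φ w₀ R lo hi j κ rs cS cU k).pick c,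
        x ≠ x' → x' ∉ ballFin G x (2 * rs) :=
  have h := apartSel_spec (fun x => ballFin G x (2 * rs)) (Skel.center_mem_ballFin' rs) (Skel.ballFin_symm' rs) (Skel.pow_succ_pos' Φ.Δ rs)
    (fun x => card_ballFin_le G Φ.degree_le x (2 * rs)) hc
  ⟨h.2.1, h.2.2⟩

/-! ## §4 Avoidance and the Step-III axioms -/

variable {Φ}
variable {w₀ : V} {R : ℕ} {lo hi : Site 2} {j rs cS cU : ℕ} {κ : KitGeom V}

/-- **Seeds avoid the pairs of any vertex set missing `{x} ∪ S x`** (Step V's `hSseed`). [cite: KozmaNitzan2024, §4 p. 21 ("Q ⊆ S")] -/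
theorem seed_notMem_wireSet {x : V} {T : Set V} (hxT : x ∉ T) (hST : ∀ v ∈ κ.S x, v ∉ T) {e : Sym2 V} (he : e ∈ kitSeed G κ x) :
    e ∉ wireSet T := by
  intro hw
  obtain ⟨⟨z, hz, hzx⟩, -⟩ := exists_mem_of_mem_kitSeed κ he
  have hzT : z ∈ T := hw.1 z hz
  rcases hzx with rfl | hzS
  · exact hxT hzT
  · exact hST z hzS hzT

variable (hκ : KitOK Φ w₀ R lo hi j rs cS cU κ)
include hκ

/-- **The Step-III axioms for the abstract seed kit of a window level** (instance-polymorphic; face vertices may lie in the region):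
`KNLevels.SHyp L j (kitSData …)` for every window level data `L = winLData Φ w₀ R lo hi o Sfin`. [cite: KozmaNitzan2024, §4 p. 19 (Step III)] -/
theorem shyp_kit (o : V) (Sfin : Finset V) (k : ℕ) :
    SHyp (winLData Φ w₀ R lo hi o Sfin) j (kitSData Φ w₀ R lo hi j κ rs cS cU k) where
  Kont_sub ω := by
    rw [kitSData_K]
    exact (winLData Φ w₀ R lo hi o Sfin).Kont_subset j ω
  edge x hx e he := by
    rw [kitSData_K] at hx
    rw [kitSData_seed] at he
    have hball : ∀ z ∈ e, z ∈ graphBall G w₀ R := by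
      intro z hz
      rcases (exists_mem_of_mem_kitSeed κ he).2 z hz with rfl | rfl | h | h
      · exact ((mem_outerBoundary_win_iff Φ).1 hx).1
      · exact winLevel_subset_graphBall Φ w₀ R lo hi j (hκ.S_sub _ hx (hκ.y_mem _ hx))
      · exact winLevel_subset_graphBall Φ w₀ R lo hi j (hκ.S_sub _ hx h)
      · exact winLevel_subset_graphBall Φ w₀ R lo hi j (hκ.U_sub _ hx h)
    have hG : e ∈ G.edgeSet := by
      rcases mem_kitSeed_cases κ he with rfl | h | ⟨v, -, u, -, hvu, rfl⟩
      · exact (SimpleGraph.mem_edgeSet (G := G)).2 (hκ.adj _ hx)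
      · exact ((mem_edgesIn_iff).1 h).1
      · exact (SimpleGraph.mem_edgeSet (G := G)).2 hvu
    induction e using Sym2.ind with
    | h a b =>
      rw [SimpleGraph.mem_edgeSet] at hG ⊢
      exact (winGraph_adj G).2 ⟨hG, hball a (Sym2.mem_mk_left a b), hball b (Sym2.mem_mk_right a b)⟩
  within x hx e he z hz := by
    rw [kitSData_K] at hx
    rw [kitSData_seed] at he
    rw [winLData_X]
    have hmono := winLevel_monotone Φ w₀ R lo hi (Nat.le_succ j)
    rcases (exists_mem_of_mem_kitSeed κ he).2 z hz with rfl | rfl | h | h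
    · exact winLevel_nest Φ w₀ R lo hi j hx
    · exact hmono (hκ.S_sub _ hx (hκ.y_mem _ hx))
    · exact hmono (hκ.S_sub _ hx h)
    · exact hmono (hκ.U_sub _ hx h)
  touch x hx e he := by
    rw [kitSData_K] at hx
    rw [kitSData_seed] at he
    rw [winLData_X]
    rcases mem_kitSeed_cases κ he with rfl | h | ⟨v, hv, u, -, -, rfl⟩
    · exact ⟨κ.y x, Sym2.mem_mk_right _ _, hκ.S_sub _ hx (hκ.y_mem _ hx)⟩
    · induction e using Sym2.ind with
      | h a b => exact ⟨a, Sym2.mem_mk_left a b, hκ.S_sub _ hx (((mem_edgesIn_iff).1 h).2 a (Sym2.mem_mk_left a b))⟩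
    · exact ⟨v, Sym2.mem_mk_left _ _, hκ.S_sub _ hx hv⟩
  card_le x hx := by
    rw [kitSData_K] at hx
    simp only [kitSData_seed, kitSeed]
    calc ({s(x, κ.y x)} ∪ edgesIn G (κ.S x) ∪
            ((κ.S x ×ˢ κ.U x).filter fun q => G.Adj q.1 q.2).image fun q => s(q.1, q.2)).card
        ≤ ({s(x, κ.y x)} ∪ edgesIn G (κ.S x)).card +
            (((κ.S x ×ˢ κ.U x).filter fun q => G.Adj q.1 q.2).image fun q => s(q.1, q.2)).card := Finset.card_union_le _ _
      _ ≤ (1 + Φ.Δ * cS) + cS * cU := by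
          refine Nat.add_le_add ((Finset.card_union_le _ _).trans (Nat.add_le_add (by simp) ?_)) ?_
          · have hE : (edgesIn G (κ.S x)).card ≤ Φ.Δ * (κ.S x).card :=
              calc (edgesIn G (κ.S x)).card ≤ (edgesTouching G (κ.S x)).card :=
                    Finset.card_le_card (edgesIn_subset_edgesTouching _)
                _ ≤ ∑ v ∈ κ.S x, (G.incidenceFinset v).card := Finset.card_biUnion_le
                _ ≤ ∑ _v ∈ κ.S x, Φ.Δ := Finset.sum_le_sum fun v _ => by
                    rw [SimpleGraph.card_incidenceFinset_eq_degree]; exact Φ.degree_le v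
                _ = Φ.Δ * (κ.S x).card := by rw [Finset.sum_const, smul_eq_mul, mul_comm]
            exact hE.trans (Nat.mul_le_mul_left _ (hκ.S_card _ hx))
          · calc (((κ.S x ×ˢ κ.U x).filter fun q => G.Adj q.1 q.2).image fun q => s(q.1, q.2)).card
                ≤ ((κ.S x ×ˢ κ.U x).filter fun q => G.Adj q.1 q.2).card := Finset.card_image_le
              _ ≤ (κ.S x ×ˢ κ.U x).card := Finset.card_filter_le _ _
              _ = (κ.S x).card * (κ.U x).card := Finset.card_product _ _
              _ ≤ cS * cU := Nat.mul_le_mul (hκ.S_card _ hx) (hκ.U_card _ hx)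
      _ = 1 + Φ.Δ * cS + cS * cU := rfl
  conn x hx ω hω u hu := by
    rw [kitSData_K] at hx
    rw [kitSData_seed] at hω
    rw [kitSData_face] at hu
    have h1 : (openGraph ω).Adj x (κ.y x) := by
      rw [openGraph_adj]
      exact ⟨hω (Finset.mem_coe.2 (contactEdge_mem_kitSeed κ x)), (hκ.adj _ hx).ne⟩
    -- the open region carries open paths
    have hE : ∀ e ∈ edgesIn G (κ.S x), e ∈ ω := fun e he => hω (Finset.mem_coe.2 (edgesIn_subset_kitSeed κ x he))
    have h2 : ∀ v ∈ κ.S x, (openGraph ω).Reachable (κ.y x) v := by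
      intro v hv
      obtain ⟨ha, hp⟩ := hκ.S_path _ hx v hv
      clear hv
      induction hp with
      | refl => exact SimpleGraph.Reachable.refl _
      | @tail b c hab hc ih =>
        have hb : b ∈ (↑(κ.S x) : Set V) := (show PathIn G (↑(κ.S x) : Set V) (κ.y x) b from ⟨ha, hab⟩).right_mem
        refine ih.trans (SimpleGraph.Adj.reachable ?_)
        rw [openGraph_adj]
        refine ⟨hE _ ?_, hc.1.ne⟩
        rw [mem_edgesIn_iff]
        refine ⟨(SimpleGraph.mem_edgeSet (G := G)).2 hc.1, fun w hw => ?_⟩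
        rcases Sym2.mem_iff.1 hw with rfl | rfl
        · exact Finset.mem_coe.1 hb
        · exact Finset.mem_coe.1 hc.2
    rcases hκ.U_adj _ hx u hu with huS | ⟨v, hv, hvu⟩
    · exact h1.reachable.trans (h2 u huS)
    · have h3 : (openGraph ω).Adj v u := by
        rw [openGraph_adj]
        exact ⟨hω (Finset.mem_coe.2 (rung_mem_kitSeed κ hv hu hvu)), hvu.ne⟩
      exact h1.reachable.trans ((h2 v hv).trans h3.reachable)
  pick_sub c := kitSData_pick_subset Φ w₀ R lo hi j κ rs cS cU k c
  pick_card c hcK hc := (kitSData_pick_spec Φ w₀ R lo hi j κ rs cS cU k hc).1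
  pick_disj c hcK hc := by
    rw [kitSData_K] at hcK
    have hball : ∀ x ∈ outerBoundary (winGraph G w₀ R) (winLevel Φ w₀ R lo hi j), ∀ e ∈ kitSeed G κ x, ∀ z ∈ e,
        z ∈ graphBall G x rs := by
      intro x hx e he z hz
      rcases (exists_mem_of_mem_kitSeed κ he).2 z hz with rfl | rfl | h | h
      · exact mem_graphBall_self G _ rs
      · exact hκ.S_ball _ hx _ (hκ.y_mem _ hx)
      · exact hκ.S_ball _ hx _ h
      · exact hκ.U_ball _ hx _ h
    refine pairwiseDisjoint_apartSel (fun x => ballFin G x (2 * rs)) (Skel.center_mem_ballFin' rs) (Skel.ballFin_symm' rs)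
      (Skel.pow_succ_pos' Φ.Δ rs) (fun x => card_ballFin_le G Φ.degree_le x (2 * rs)) hc fun x hx x' hx' hfar => ?_
    rw [Finset.disjoint_left]
    intro e he he'
    induction e using Sym2.ind with
    | h a b =>
      have ha := hball x (hcK hx) _ he a (Sym2.mem_mk_left a b)
      have ha' := hball x' (hcK hx') _ he' a (Sym2.mem_mk_left a b)
      refine hfar ((mem_ballFin G).2 ?_)
      have h := BoxProdZ2.mem_graphBall_add G ha ((BoxProdZ2.mem_graphBall_comm G).1 ha')
      rwa [two_mul]

end SkelI

end Transplant

end Summit.CriticalPhenomena.PercolationContinuityZ3.Theorems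

end
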